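import Summits.BirchSwinnertonDyer.BirchSwinnertonDyer.Theorems.KolyvaginRankRigidityAtTwoSwapHybridFrameNine
import Summits.BirchSwinnertonDyer.BirchSwinnertonDyer.Theorems.KolyvaginRankRigidityAtTwoKolyvaginCorankLowerBoundAtTwoMarginChebotarevOneClassIndexAtTwo
import Summits.BirchSwinnertonDyer.BirchSwinnertonDyer.Theorems.Rank1ResidualJetWeilDatum
import Summits.BirchSwinnertonDyer.BirchSwinnertonDyer.Theorems.Rank1ResidualJetRingClassFields
import Summits.BirchSwinnertonDyer.BirchSwinnertonDyer.Theorems.Rank1ResidualJetCoreVertexBridge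
import Summits.BirchSwinnertonDyer.BirchSwinnertonDyer.Theorems.PoitouTateSelmerStructureDualityConjHolds
import Literature.NumberTheory.EllipticCurves.HeegnerPointsKolyvaginExceptionalSelmerProofs
import Literature.NumberTheory.EllipticCurves.WeilPairingTateDual
import Literature.NumberTheory.Sieve.FriedlanderIwaniecPrimesSquarefreeProofs
import HarnessLib

/-!
# Crux V2♭θ / V2♭∞ (stmt-BirchSwinnertonDyer-27220; line `kolyvagin_depth_split`), stub S1 — the LOSSY prime swap
# at 2 (registered text of `stub_primeSwapAtTwoLossy`, Finset currency) FROM ONE NAMED PRINT FACT (Gross 3.7 (2))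

`primeSwapAtTwoLossy_of_namedFacts`: the registered S1L text (line `kolyvagin_depth_split`, ∞-skeleton
`Lines/kolyvagin_depth_split_rich.lean`; the LOSSY prime swap with constants `c₀, c₂` chosen before the frame) for EVERY
curve of the habitat, from exactly ONE named print fact:
* `GrossLMS1991.prop37_2_frobeniusCongruence` (Gross 1991 Prop. 3.7 (2) = Nekovář 2007 Prop. 4.9, image-free; ⇒ Q2
  `KolyvaginRelationAtTwo`, p614530) —
Poitou–Tate duality for finite Selmer structures being a THEOREM of the tree since 2026-08-28
(`InputsPoitouTateSelmer.poitouTate_selmerStructure_duality_conj_holds`, cells bsd-inputs / bsd-schneider / bsd-jet), by `primeSwapAtTwoLossy_core_hybrid_nine` (P4, P5, P6, P7, P8, pair Čebotarev, S2, T2, T3 all landed) on the frame built here: `τ` the non-trivial automorphism of `K`; per level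
`2^M` a `τ`-equivariant Weil datum (`JET.exists_weilDatum_liftAut`; the trivial datum at `M = 0`), the Poitou–Tate
family of the named fact, and the HYBRID transverse structure (`exists_hybridTransverseFamily`: ring-class transverse
condition at the Kolyvagin places of index `≥ M + 1`, Kummer elsewhere); S2 in-tree (c₁), T2 with `t = |Δ_min| + 4`.
Constants: `c₀ = 2 (c₁ + |Δ_min| + 19)`, `c₂ = c₁ + 6` (`c₁` of S2).
HONEST FRAMING: CONDITIONAL on the one named fact (conditional-result); this is the stub S1L of the ∞-form line, NOT
the registered lossless stub `stub_primeSwapAtTwo` of the θ-form line; nothing here proves V2♭θ, V2♭∞ or BSD.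
[cite: Kolyvagin1991MathAnn, §2 Thm. 2.2, p. 257] [cite: McCallumLMS1991, §5 Prop. 5.2] [cite: WZhang2014, Lemma 8.4]
[cite: GrossLMS1991, Prop. 3.7 (2)] [cite: MilneADT2006, Ch. I, Thm. 4.10]
-/

set_option autoImplicit false
set_option linter.dupNamespace false

noncomputable section

open scoped Classical Pointwise
open Function NumberField IsDedekindDomain WeierstrassCurve Field
open Literature.NumberTheory.EllipticCurves Literature.NumberTheory.GaloisRepresentations
open Literature.NumberTheory.EllipticCurves.Jetchev2008 Literature.NumberTheory.EllipticCurves.ModularForms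
open Literature.NumberTheory.GaloisCohomology
open Literature.NumberTheory.GaloisRepresentations.DiscreteGaloisModule (localTatePairingZMod
  tateDual transverseSubgroup SelmerStructure)
open Literature.NumberTheory.Automorphic
open Summit.BirchSwinnertonDyer.Rank1Residual
open Summit.BirchSwinnertonDyer.Rank1Residual.JET.SelmerVocabulary
open Summit.BirchSwinnertonDyer.Rank1Residual.JET.GlobalDuality
open Summit.BirchSwinnertonDyer.BirchSwinnertonDyer.Theses.KolyvaginRankRigidityAtTwo
open Literature.NumberTheory.EllipticCurves.GrossLMS1991 (prop37_2_frobeniusCongruence)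

namespace Summit.BirchSwinnertonDyer.BirchSwinnertonDyer.Theorems.KolyvaginLowerBoundAtTwo

variable {K : Type} [Field K] [NumberField K] (W : WeierstrassCurve ℚ) [W.IsElliptic] [W.IsGloballyMinimal]

/-! ## §1 The frame data at level `2^M` -/

omit [W.IsGloballyMinimal] in
/-- **A `τ`-equivariant Weil datum on `E[2^M]` for every `M`** (`JET.exists_weilDatum_liftAut` for `M ≥ 1`; at
`M = 0` the trivial datum on `E[1] = 0`). [cite: SilvermanAEC2009, III §8] -/
theorem exists_weilDatum_liftAut_two_pow (τ : K ≃ₐ[ℚ] K) (M : ℕ) :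
    ∃ e : geomTorsion (W.baseChange K) ((2 ^ M : ℕ) : ℤ) → geomTorsion (W.baseChange K) ((2 ^ M : ℕ) : ℤ) →
        AlgebraicClosure K,
      (∀ S T, e S T ^ (2 ^ M) = 1) ∧
      (∀ S₁ S₂ T, e (S₁ + S₂) T = e S₁ T * e S₂ T) ∧
      (∀ S T₁ T₂, e S (T₁ + T₂) = e S T₁ * e S T₂) ∧
      (∀ (g : absoluteGaloisGroup K) (S T : geomTorsion (W.baseChange K) ((2 ^ M : ℕ) : ℤ)),
        g • e S T = e (g • S) (g • T)) ∧
      (∀ T, e T T = 1) ∧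
      (∀ T, (∀ S, e S T = 1) → T = 0) ∧
      ∀ S T, liftAut τ (e S T) =
        e ((isLiftOfAut_liftAut τ).torsionMap W ((2 ^ M : ℕ) : ℤ) S)
          ((isLiftOfAut_liftAut τ).torsionMap W ((2 ^ M : ℕ) : ℤ) T) := by
  rcases Nat.eq_zero_or_pos M with rfl | hM
  · refine ⟨fun _ _ ↦ 1, fun _ _ ↦ one_pow _, fun _ _ _ ↦ (mul_one _).symm, fun _ _ _ ↦ (mul_one _).symm,
      fun g _ _ ↦ smul_one g, fun _ ↦ rfl, fun T _ ↦ ?_, fun _ _ ↦ map_one _⟩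
    have h : (2 ^ 0) • T = 0 := AddSubgroup.torsionBy.nsmul T
    have h1 : (1 : ℕ) • T = 0 := h
    rwa [one_nsmul] at h1
  · exact JET.exists_weilDatum_liftAut W τ (2 ^ M) (le_trans (by norm_num) (Nat.pow_le_pow_right two_pos hM))

omit [W.IsElliptic] in
/-- **The HYBRID transverse structure at level `2^M`**: a Selmer structure on `E[2^M]/K` equal to the ring-class
transverse condition `⨅_{w' ∣ v} ker(H¹(K_v) → H¹(K[q]_{w'}))` at every place `v ∋ q` of a Kolyvagin prime `q` at `2`
of index `≥ M + 1`, and to the Kummer condition at every other finite place (Mazur–Rubin's `𝓕(c)` read place by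
place; built from `JET.Walk.exists_globalTransverseFamily`). [cite: MazurRubin2004, Def. 1.1.6]
[cite: Jetchev2008, §3.1.2 (p. 814), §3.4.1 (p. 816)] -/
theorem exists_hybridTransverseFamily [NeZero (W.conductorNorm ℤ)] (ι : K →+* ℂ)
    [∀ j : ℕ, NumberField (ringClassField K ι j)] (M : ℕ) :
    ∃ 𝒯 : SelmerStructure ((W.baseChange K).torsionGaloisModule ((2 ^ M : ℕ) : ℤ)),
      (∀ (v : HeightOneSpectrum (𝓞 K)) (q : ℕ),
        Zhang2014.IsKolyvaginPrime (W.conductorNorm ℤ) W K 2 q → M + 1 ≤ Zhang2014.kolyvaginIndex W 2 q →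
        (q : 𝓞 K) ∈ v.asIdeal →
        𝒯 (Sum.inr v) = ⨅ (w' : HeightOneSpectrum (𝓞 (ringClassField K ι q)))
            (_ : w'.asIdeal.LiesOver v.asIdeal),
            letI := (adicCompletionOfLiesOver K (ringClassField K ι q) v w').toAlgebra
            transverseSubgroup (GaloisRep.toLocal v ((W.baseChange K).torsionGaloisModule ((2 ^ M : ℕ) : ℤ)))
              (w'.adicCompletion (ringClassField K ι q))) ∧
      (∀ v : HeightOneSpectrum (𝓞 K),
        (¬ ∃ q : ℕ, Zhang2014.IsKolyvaginPrime (W.conductorNorm ℤ) W K 2 q ∧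
            M + 1 ≤ Zhang2014.kolyvaginIndex W 2 q ∧ (q : 𝓞 K) ∈ v.asIdeal) →
        𝒯 (Sum.inr v) = (W.baseChange K).kummerSelmerStructure ((2 ^ M : ℕ) : ℤ) (Sum.inr v)) := by
  obtain ⟨𝒯g, h𝒯g, -⟩ := JET.Walk.exists_globalTransverseFamily W ι ((2 ^ M : ℕ) : ℤ)
  refine ⟨fun v ↦ match v with
    | Sum.inl w => (W.baseChange K).kummerSelmerStructure ((2 ^ M : ℕ) : ℤ) (Sum.inl w)
    | Sum.inr v => if (∃ q : ℕ, Zhang2014.IsKolyvaginPrime (W.conductorNorm ℤ) W K 2 q ∧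
          M + 1 ≤ Zhang2014.kolyvaginIndex W 2 q ∧ (q : 𝓞 K) ∈ v.asIdeal) then 𝒯g (Sum.inr v)
        else (W.baseChange K).kummerSelmerStructure ((2 ^ M : ℕ) : ℤ) (Sum.inr v),
    fun v q hq hMq hqv ↦ ?_, fun v h ↦ ?_⟩
  · have h : ∃ q : ℕ, Zhang2014.IsKolyvaginPrime (W.conductorNorm ℤ) W K 2 q ∧
        M + 1 ≤ Zhang2014.kolyvaginIndex W 2 q ∧ (q : 𝓞 K) ∈ v.asIdeal := ⟨q, hq, hMq, hqv⟩
    change (if _ then _ else _) = _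
    rw [if_pos h]
    exact JET.Walk.globalTransverse_eq_of_natCast_mem h𝒯g v hq.1 hqv
  · change (if _ then _ else _) = _
    rw [if_neg h]

/-! ## §2 The registered S1L text from Gross 3.7 (2) -/

/-- **S1L (the LOSSY prime swap at `2`, registered text of the ∞-line's stub) from Gross 1991 Prop. 3.7 (2)**
(Poitou–Tate duality supplied by the tree theorem `poitouTate_selmerStructure_duality_conj_holds`) — Kolyvagin's
[1] Prop. 8 = McCallum Prop. 5.2 = W. Zhang L8.4 step at `p = 2`, with a constant loss `c₂ = c₁ + 6` per swap under the
relative-order condition `M + c₀ ≤ 2j`. CONDITIONAL on `h37` (named print fact); nothing here proves V2♭θ, V2♭∞ or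
BSD. [cite: Kolyvagin1991MathAnn, §2 Thm. 2.2, p. 257] [cite: McCallumLMS1991, §5 Prop. 5.2] [cite: WZhang2014, Lemma 8.4] -/
theorem primeSwapAtTwoLossy_of_namedFacts (h37 : prop37_2_frobeniusCongruence) :
    ∀ (W : WeierstrassCurve ℚ) [W.IsElliptic] [W.IsGloballyMinimal], ¬ W.HasCM →
      (Rank1Residual.GoodOrd W 2 ∨ Rank1Residual.Mult W 2) →
      (∀ m : ℕ, W.HasSurjectiveModNGaloisRep (2 ^ m : ℕ)) →
      ∀ (K : Type) [Field K] [NumberField K], IsImaginaryQuadratic K → NumberField.discr K ≠ -3 →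
      NumberField.discr K ≠ -4 → ¬ ((2 : ℤ) ∣ NumberField.discr K) → ∀ [NeZero (W.conductorNorm ℤ)],
      SatisfiesHeegnerHypothesis (W.conductorNorm ℤ) K →
      ∃ c₀ c₂ : ℕ, ∀ (Dt : ModularParametrizationData W (W.conductorNorm ℤ)) (β : ℤ) (ι : K →+* ℂ),
        ∀ (M I : ℕ) (T : Finset ℕ) (a : ℕ)
          (dat : KolyvaginHeegnerData Dt β ι (∏ p ∈ T, p)) (j : ℕ) (X : Finset ℕ),
          1 ≤ M → M + 1 ≤ I →
          (∀ p ∈ T, Zhang2014.IsKolyvaginPrime (W.conductorNorm ℤ) W K 2 p ∧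
            M + 1 ≤ Zhang2014.kolyvaginIndex W 2 p) →
          a ∈ T → M + c₀ ≤ 2 * j →
          (∀ X' : Finset ℕ, ∃ q : ℕ, q ∉ X' ∧ Zhang2014.IsKolyvaginPrime (W.conductorNorm ℤ) W K 2 q ∧
            I ≤ Zhang2014.kolyvaginIndex W 2 q ∧
            ∃ v : HeightOneSpectrum (𝓞 K), ((q : ℕ) : 𝓞 K) ∈ v.asIdeal ∧
              ((2 ^ j : ℕ) : ℤ) • dat.kolyvaginClass Nat.prime_two M ∉
                (W.baseChange K).torsionLocalKer (v.adicCompletion K) ((2 ^ M : ℕ) : ℤ)) →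
          ∃ ℓ : ℕ, ℓ ∉ X ∧ ℓ ∉ T ∧ Zhang2014.IsKolyvaginPrime (W.conductorNorm ℤ) W K 2 ℓ ∧
            I ≤ Zhang2014.kolyvaginIndex W 2 ℓ ∧
            (∃ v : HeightOneSpectrum (𝓞 K), ((ℓ : ℕ) : 𝓞 K) ∈ v.asIdeal ∧
              ((2 ^ (j - c₂) : ℕ) : ℤ) • dat.kolyvaginClass Nat.prime_two M ∉
                (W.baseChange K).torsionLocalKer (v.adicCompletion K) ((2 ^ M : ℕ) : ℤ)) ∧
            ∃ dat' : KolyvaginHeegnerData Dt β ι (∏ p ∈ insert ℓ (T.erase a), p),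
              (∀ X' : Finset ℕ, ∃ q : ℕ, q ∉ X' ∧ Zhang2014.IsKolyvaginPrime (W.conductorNorm ℤ) W K 2 q ∧
                I ≤ Zhang2014.kolyvaginIndex W 2 q ∧
                ∃ v : HeightOneSpectrum (𝓞 K), ((q : ℕ) : 𝓞 K) ∈ v.asIdeal ∧
                  ((2 ^ (j - c₂) : ℕ) : ℤ) • dat'.kolyvaginClass Nat.prime_two M ∉
                    (W.baseChange K).torsionLocalKer (v.adicCompletion K) ((2 ^ M : ℕ) : ℤ)) := by
  intro W _ _ hCM hred hsur K _ _ hK hne3 hne4 h2d _ hHN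
  classical
  haveI : Fact (Nat.Prime 2) := ⟨Nat.prime_two⟩
  obtain ⟨c₁, hS2⟩ := stub_chebotarevOneClassIndexAtTwo W hCM hred hsur K hK hne3 hne4 h2d hHN
  refine ⟨2 * (c₁ + 5 + 2 + 0 + ((minimalDiscriminantInt W).natAbs + 4) + 8), c₁ + 2 + 0 + 4, ?_⟩
  intro Dt β ι M I T a dat j X hM hMI hT haT hj hBig
  -- the frame: `τ`, instances, Weil data, Poitou–Tate families, hybrid structures (per level)
  obtain ⟨τ, hτ1⟩ := JET.exists_algEquiv_ne_one_of_isImaginaryQuadratic K hK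
  have hττ : τ * τ = 1 := mul_self_eq_one_of_isImaginaryQuadratic hK τ
  haveI : ∀ j : ℕ, NumberField (ringClassField K ι j) := JET.numberField_ringClassField K hK ι
  haveI : (W.baseChange K).IsElliptic := by rw [baseChange]; infer_instance
  haveI hNZ : ∀ M : ℕ, NeZero (2 ^ M) := fun M ↦ ⟨pow_ne_zero M two_ne_zero⟩
  haveI : ∀ M : ℕ, Finite (geomTorsion (W.baseChange K) ((2 ^ M : ℕ) : ℤ)) := fun M ↦
    finite_geomTorsion_of_neZero (W.baseChange K) (2 ^ M)
  have hinv : ∀ M : ℕ, ∃ inv : LocalInvariants K (2 ^ M), inv.IsPerfect ∧ inv.SumLocalTermEqZero ∧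
      inv.UnramifiedOrthogonal ∧ inv.SelmerComplement ∧ ∀ σ : K ≃ₐ[ℚ] K, inv.IsConjCompatible σ :=
    fun M ↦ InputsPoitouTateSelmer.poitouTate_selmerStructure_duality_conj_holds K (2 ^ M)
  choose inv hperf hvan hUO hSC hconj using hinv
  have hweil := fun M : ℕ ↦ exists_weilDatum_liftAut_two_pow (K := K) W τ M
  choose e hμ hadd₁ hadd₂ hgal halt hnondeg hτe using hweil
  have hhyb := fun M : ℕ ↦ exists_hybridTransverseFamily (K := K) W ι M
  choose 𝒯 hTko hTku using hhyb
  -- conductor currency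
  have hTp : ∀ p ∈ T, p.Prime := fun p hp ↦ (hT p hp).1.1
  have hpf : (∏ p ∈ T, p).primeFactors = T := Nat.primeFactors_prod hTp
  obtain ⟨ℓ, hℓX, hℓT, hKol, hIℓ, -, hv, dat', hBig'⟩ :=
    primeSwapAtTwoLossy_core_hybrid_nine (W := W) (τ := τ) (Dt := Dt) (β := β) (ι := ι) (e := e) (hμ := hμ)
      (hadd₁ := hadd₁) (hadd₂ := hadd₂) (hgal := hgal) (halt := halt) (hnondeg := hnondeg) (hτe := hτe)
      (inv := inv) (𝒯 := 𝒯) (hCM := hCM) (hred := hred) (hsur := hsur) (hK := hK) (hne3 := hne3)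
      (hne4 := hne4) (h2d := h2d) (hHN := hHN) (hτ1 := hτ1) (hττ := hττ) (hperf := hperf) (hvan := hvan)
      (hinvc := fun M ↦ hconj M τ) (hSC := hSC) (hTko := hTko) (hTku := hTku) (h37 := h37) (hS2 := hS2 Dt β ι)
      X dat hM hMI (Literature.NumberTheory.Sieve.FriedlanderIwaniecPrimesSquarefree.squarefree_prod_of_primes hTp)
      (by rw [hpf]; exact hT) (by rw [hpf]; exact haT) hj hBig
  rw [hpf] at hℓT
  have hdiv : (∏ p ∈ T, p) / a * ℓ = ∏ p ∈ insert ℓ (T.erase a), p := by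
    rw [show (∏ p ∈ T, p) / a = ∏ p ∈ T.erase a, p from
        Nat.div_eq_of_eq_mul_right (hTp a haT).pos (by rw [Finset.mul_prod_erase T (fun p ↦ p) haT]),
      Finset.prod_insert (fun h ↦ hℓT (Finset.mem_of_mem_erase h)), mul_comm]
  refine ⟨ℓ, hℓX, hℓT, hKol, hIℓ, hv, hdiv ▸ dat', fun X' ↦ ?_⟩
  obtain ⟨q, hqX, hKq, hIq, v, hvq, hloc⟩ := hBig' X'
  exact ⟨q, hqX, hKq, hIq, v, hvq, by rw [kolyvaginClass_cast_swap]; exact hloc⟩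

end Summit.BirchSwinnertonDyer.BirchSwinnertonDyer.Theorems.KolyvaginLowerBoundAtTwo

end
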